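import Summits.KontsevichZagierPeriods.KontsevichZagierPeriods.Theorems.HurwitzMicroSectorsNormalFormPrinciplePiPowersKernelEta
import Summits.KontsevichZagierPeriods.KontsevichZagierPeriods.Theorems.HurwitzMicroSectorsNormalFormPrincipleM3KernelAperyEight

/-!
# `NormalFormPrinciple` (stmt-KontsevichZagierPeriods-3869), line `SketchIdeator1` —
# the second leaf, `stub_piCancellation`, on the kernelled subgroups (unconditional)

Pure proof file (lead seat c9; `--supports` the crux). The skeleton of the line closes the crux from
TWO conjecture-grade leaves, `stub_boxRigidity` (Conjecture 1 on rational boxes) and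
`stub_piCancellation` (`KZ.PiCancellation`: `[π]·c ∈ relations → c ∈ relations`). Wherever the first
leaf is known in KERNEL form on a subgroup `S` (`eval c = 0 → c ∈ relations` for `c ∈ S`), the second
follows on `S` at once: `[π]·c ∈ relations` forces `π · eval c = 0` (soundness, `KZ.eval_piRep_mul`),
so `eval c = 0`. Hence BOTH leaves of the skeleton hold unconditionally on the `π`-powers subgroup
(`piPowersEta_mem_relations_of_eval_eq_zero`) and on the Apéry subgroup
(`m3ZetaEightFamiliesPoly_mem_relations_of_eval_eq_zero`) — with any number `k` of factors `[π]`.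
References: M. Kontsevich, D. Zagier, *Periods* (2001), §1.2, §4.1. No definitions are introduced.
-/

noncomputable section

open MeasureTheory Set
open Literature.NumberTheory.Transcendental Literature.NumberTheory.Transcendental.KZ

namespace Summit.KontsevichZagierPeriods.HurwitzMicroSectors.NormalFormPrinciple.PiBox.M3

/-- **Kernel form implies `π`-cancellation, subgroup by subgroup.** If every element of a subgroup
`S` of formal representations with value `0` is a relation, then `[π]·(…([π]·c)) ∈ relations`
(`k` factors) forces `c ∈ relations` for every `c ∈ S`. [cite: KontsevichZagier2001, §4.1] -/
theorem piPow_cancel_of_kernelOn {S : AddSubgroup FormalRep}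
    (hker : ∀ c ∈ S, eval c = 0 → c ∈ relations) (k : ℕ) {c : FormalRep} (hc : c ∈ S)
    (h : (fun x => of piRep * x)^[k] c ∈ relations) : c ∈ relations := by
  refine hker c hc ?_
  have hev : ∀ (k : ℕ) (c : FormalRep), eval ((fun x => of piRep * x)^[k] c) = Real.pi ^ k * eval c := by
    intro k
    induction k with
    | zero => intro c; simp
    | succ k ih =>
      intro c
      rw [Function.iterate_succ_apply', eval_piRep_mul, ih, pow_succ', mul_assoc]
  have h0 : eval ((fun x => of piRep * x)^[k] c) = 0 := relations_le_ker_eval_holds h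
  rw [hev] at h0
  exact (mul_eq_zero.1 h0).resolve_left (pow_ne_zero _ Real.pi_pos.ne')

/-- **`stub_piCancellation` UNCONDITIONALLY on the `π`-powers subgroup** (lead seat c9, line
`SketchIdeator1`): for `c` in the subgroup of `piPowersEta_mem_relations_of_eval_eq_zero`,
`[π]·(…([π]·c)) ∈ KZ.relations` (`k` factors) `→ c ∈ KZ.relations`. [cite: KontsevichZagier2001, §4.1] -/
theorem piPowers_piPow_cancel (k : ℕ) {c : FormalRep}
    (hc : c ∈ AddSubgroup.closure
      (({y : FormalRep | ∃ (k : ℕ) (S : Finset ℕ) (coef : ℕ → ℝ) (N : IntegralRep (2 * (k + 1))),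
          (∀ i ∈ S, IsAlgebraic ℚ (coef i)) ∧ N.domain = {x | ∀ i, x i ∈ Set.Ioo (0:ℝ) 1} ∧
          EqOn N.integrand (fun x => (∑ i ∈ S, coef i * (∏ l, x l) ^ i) / (1 - ∏ l, x l)) N.domain ∧
          y = of N} ∪
       {y : FormalRep | ∃ (w : ℕ) (c : ℝ) (N : IntegralRep w), IsAlgebraic ℚ c ∧
          N.domain = {x | ∀ i, x i ∈ Set.Ioo (0:ℝ) 1} ∧ EqOn N.integrand (fun _ => c) N.domain ∧ y = of N} ∪
       {y : FormalRep | ∃ (r : ℝ) (Z : IntegralRep 0), IsAlgebraic ℚ r ∧ Z.domain = Set.univ ∧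
          (Z.integrand = fun _ => r) ∧ y = of Z} ∪
       {y : FormalRep | ∃ (m : ℕ) (p : MvPolynomial (Fin m) ℚ) (N : IntegralRep m),
          N.domain = {x | ∀ i, x i ∈ Set.Ioo (0:ℝ) 1} ∧
          EqOn N.integrand (fun x => (MvPolynomial.aeval x p : ℝ)) N.domain ∧ y = of N} ∪
       {y : FormalRep | ∃ (P : MvPolynomial (Fin 2) ℚ) (N : IntegralRep 2),
          N.domain = {x | ∀ i, x i ∈ Set.Ioo (0:ℝ) 1} ∧
          EqOn N.integrand (fun x => (MvPolynomial.aeval x P : ℝ) / (1 - x 0 * x 1)) N.domain ∧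
          y = of N} ∪
       {y : FormalRep | ∃ N : IntegralRep 2, N.domain = {x | ∀ i, x i ∈ Set.Ioo (0:ℝ) 1} ∧
          EqOn N.integrand (fun x => 1 / (1 + x 0 * x 1)) N.domain ∧ y = of N} ∪
       {y : FormalRep | ∃ N : IntegralRep 2, N.domain = {x | ∀ i, x i ∈ Set.Ioo (0:ℝ) 1} ∧
          EqOn N.integrand (fun x => 4 * x 0 * x 1 / (1 - x 0 ^ 2 * x 1 ^ 2)) N.domain ∧ y = of N} ∪
       {y : FormalRep | ∃ N : IntegralRep 2, N.domain = {x | ∀ i, x i ∈ Set.Ioo (0:ℝ) 1} ∧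
          EqOn N.integrand (fun x => 1 / (-1 - x 0 * x 1)) N.domain ∧ y = of N} ∪
       {y : FormalRep | ∃ N : IntegralRep 4, N.domain = {x | ∀ i, x i ∈ Set.Ioo (0:ℝ) 1} ∧
          EqOn N.integrand (fun x => 1 / (1 - x 0 * x 1 * x 2 * x 3)) N.domain ∧ y = of N} ∪
       {y : FormalRep | ∃ N : IntegralRep 4, N.domain = {x | ∀ i, x i ∈ Set.Ioo (0:ℝ) 1} ∧
          EqOn N.integrand (fun x => 1 / (1 + x 0 * x 1 * x 2 * x 3)) N.domain ∧ y = of N} ∪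
       {y : FormalRep | ∃ N : IntegralRep 4, N.domain = {x | ∀ i, x i ∈ Set.Ioo (0:ℝ) 1} ∧
          EqOn N.integrand (fun x => 1 / ((1 - x 0 * x 1) * (1 - x 0 * x 1 * x 2 * x 3))) N.domain ∧ y = of N} ∪
       {y : FormalRep | ∃ N : IntegralRep 4, N.domain = {x | ∀ i, x i ∈ Set.Ioo (0:ℝ) 1} ∧
          EqOn N.integrand (fun x => 1 / ((1 - x 0 * x 1 * x 2) * (1 - x 0 * x 1 * x 2 * x 3))) N.domain ∧ y = of N} ∪
       {y : FormalRep | ∃ N : IntegralRep 4, N.domain = {x | ∀ i, x i ∈ Set.Ioo (0:ℝ) 1} ∧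
          EqOn N.integrand (fun x => 1 / ((1 - x 0 * x 1) * (1 - x 2 * x 3))) N.domain ∧ y = of N} ∪
       {y : FormalRep | ∃ N : IntegralRep 4, N.domain = {x | ∀ i, x i ∈ Set.Ioo (0:ℝ) 1} ∧
          EqOn N.integrand (fun x => 1 / ((1 - x 0 * x 1) * (1 + x 2 * x 3))) N.domain ∧ y = of N} ∪
       {y : FormalRep | ∃ N : IntegralRep 4, N.domain = {x | ∀ i, x i ∈ Set.Ioo (0:ℝ) 1} ∧
          EqOn N.integrand (fun x => 1 / ((1 + x 0 * x 1) * (1 + x 2 * x 3))) N.domain ∧ y = of N}) ∪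
       {y : FormalRep | ∃ N : IntegralRep 4, N.domain = {x | ∀ i, x i ∈ Set.Ioo (0:ℝ) 1} ∧
          EqOn N.integrand (fun x => 1 / ((1 + x 0 * x 1) * (1 - x 0 * x 1 * x 2 * x 3))) N.domain ∧
          y = of N}))
    (h : (fun x => of piRep * x)^[k] c ∈ relations) : c ∈ relations :=
  piPow_cancel_of_kernelOn (fun _ hc hv => piPowersEta_mem_relations_of_eval_eq_zero hc hv) k hc h

/-- **`stub_piCancellation` UNCONDITIONALLY on the Apéry subgroup** (eight `ζ(3)` families and the
rational polynomial boxes). [cite: KontsevichZagier2001, §4.1] -/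
theorem m3ZetaEight_piPow_cancel (k : ℕ) {c : FormalRep}
    (hc : c ∈ AddSubgroup.closure
      ({y : FormalRep | ∃ N : IntegralRep 3, N.domain = {x | ∀ i, x i ∈ Set.Ioo (0:ℝ) 1} ∧
        EqOn N.integrand (fun x => 1 / (1 - x 0 * x 1 * x 2)) N.domain ∧ y = of N} ∪
      {y : FormalRep | ∃ N : IntegralRep 3, N.domain = {x | ∀ i, x i ∈ Set.Ioo (0:ℝ) 1} ∧
        EqOn N.integrand (fun x => 2 / (1 - x 0 * x 1 * x 2)) N.domain ∧ y = of N} ∪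
      {y : FormalRep | ∃ N : IntegralRep 3, N.domain = {x | ∀ i, x i ∈ Set.Ioo (0:ℝ) 1} ∧
        EqOn N.integrand (fun x => 5 / (1 - x 0 * x 1 * x 2)) N.domain ∧ y = of N} ∪
      {y : FormalRep | ∃ N : IntegralRep 3, N.domain = {x | ∀ i, x i ∈ Set.Ioo (0:ℝ) 1} ∧
        EqOn N.integrand (fun x => 1 / ((1 - x 0 * x 1) * (1 - x 0 * x 1 * x 2))) N.domain ∧ y = of N} ∪
      {y : FormalRep | ∃ N : IntegralRep 3, N.domain = {x | ∀ i, x i ∈ Set.Ioo (0:ℝ) 1} ∧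
        EqOn N.integrand (fun x => 8 / ((1 + x 0 * x 1) * (1 + x 0 * x 1 * x 2))) N.domain ∧ y = of N} ∪
      {y : FormalRep | ∃ N : IntegralRep 3, N.domain = {x | ∀ i, x i ∈ Set.Ioo (0:ℝ) 1} ∧
        EqOn N.integrand (fun x => 16 / ((2 - x 0) * (2 - x 0 * x 1 * x 2))) N.domain ∧ y = of N} ∪
      {y : FormalRep | ∃ N : IntegralRep 3, N.domain = {x | ∀ i, x i ∈ Set.Ioo (0:ℝ) 1} ∧
        EqOn N.integrand (fun x => 1 / (1 + x 0 * x 1 * x 2)) N.domain ∧ y = of N} ∪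
      {y : FormalRep | ∃ N : IntegralRep 3, N.domain = {x | ∀ i, x i ∈ Set.Ioo (0:ℝ) 1} ∧
        EqOn N.integrand (fun x => 4 / (1 + x 0 * x 1 * x 2)) N.domain ∧ y = of N} ∪
      {y : FormalRep | ∃ (m : ℕ) (p : MvPolynomial (Fin m) ℚ) (N : IntegralRep m),
        N.domain = {x | ∀ i, x i ∈ Set.Ioo (0:ℝ) 1} ∧
        EqOn N.integrand (fun x => (MvPolynomial.aeval x p : ℝ)) N.domain ∧ y = of N}))
    (h : (fun x => of piRep * x)^[k] c ∈ relations) : c ∈ relations :=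
  piPow_cancel_of_kernelOn (fun _ hc hv => m3ZetaEightFamiliesPoly_mem_relations_of_eval_eq_zero hc hv) k hc h

end Summit.KontsevichZagierPeriods.HurwitzMicroSectors.NormalFormPrinciple.PiBox.M3
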